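import Summits.Ventures.YMGap.BEDoor.Theta

/-!
# BEDoor / Curvature — §4b the covariance bound from an ABSTRACT curvature bound
# (module 03/11 of the Bakry–Émery door, LIFT edition v8.3 = parts `Curvature` (v8.2 module 05); cell `ym-beyond`, seat P4)

HONEST FRAMING (cell `ym-beyond`, seat P4 «Hessian-currency receiver», lens Y2; HUMAN RULINGS D-0035 / D-0037; memo `HOME/ROUTE-P4Y2.md` v8.1 +
g10 addendum, spec `HOME/ROUTE-P4Y2-LIFT-SPEC-v83.md`; LIFT edition v8.3 = the v8.2 module bodies of `HOME/ROUTE-P4Y2-Sketch.lean` v8.1, byte-identical and in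
order, re-packed into 11 ≤ 400-line modules (fewer olean round-trips; director-ym line №2 (B)); the g10 appendix `OpenStrip` is a separate, UNQUEUED HOME file (line №3 (D))).  FINITE-LATTICE
statements at STRONG effective coupling: a RECEIVER («door») in HESSIAN (Bakry–Émery) currency for renormalisation-group output, typed over the
tree's generic clustering chain `Thresholds/SharpClustering*` + `Thresholds/LatticeBakryEmery*`, complementary to the Dobrushin-currency door
`YM4Door/*` (LITERALLY the same INPUT predicate `QuasiLocalGaugePerturbation.HasAnalyticNormLE … stripDomain`, the same OUTPUT predicate
`RobustBall.ClustersWith`; no residual hypothesis: Osgood regularity is the tree's `Literature.Analysis.Complex.SCV.contDiffOn_infty`,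
part `Osgood` of module `AnalyticStrip`).  Nothing here is a statement about `β → ∞`, the continuum limit or the Clay problem; NO effective action is asserted to be at
the door (that INPUT is not in print for `d = 4`); the verdict «the two windows do not meet» is unchanged in this currency.
WHAT THIS IS NOT (ladder rung R2d; director-ym line №2 (B)): every door of this LIFT is an entry on the STRONG-COUPLING BANK of THE NUMBER —
finite-lattice exponential clustering at SMALL `|β|` and small strip norm `η` of the perturbation (`SU(2)`, `d = 4`: `16.2|β| + 4.4η < 1`, module `SU2`,
conclusion literally `RobustBall.ClustersWith`) — NOT clustering at weak coupling, NOT a statement at large `β`, NOT the mass gap.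
No conjecture name, no `sorry`, no axiom beyond the standard three; every theorem is bookkeeping over the tree. [folklore]
References: H. Shen, R. Zhu, X. Zhu, CMP 400 (2023) 805 (arXiv:2204.12737) Thm 1.2, Cor. 4.4/4.11; D. Bakry, M. Émery, LNM 1123 (1985);
T. Bałaban, CMP 109 (1987) 249, (1.18)–(1.22) (analyticity format); L. Hörmander, An Introduction to Complex Analysis in Several Variables
(1973) Thm 2.2.1/2.2.6 (Osgood); E. J. McShane, Bull. AMS 40 (1934) 837 (Lipschitz extension).

THIS MODULE, part `Curvature` (§4b the covariance bound from an ABSTRACT curvature bound): `weightedEnergy_le_of_curv`, `cov_step_of_curv`,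
`covariance_le_of_curv` (the tree's energy/covariance chain re-run from an abstract curvature hypothesis), ★★ `covariance_le_theta`: `K·|Z∫e^S fg −
∫e^S f ∫e^S g| ≤ Z‖∇f‖_{1/w}‖∇g‖_w` with `K = N/2 − Λ − Θ` for ANY-range `h` and general positive weights; `covarianceLeOfCurvature_holds`.
-/

noncomputable section

open scoped Matrix ComplexConjugate BigOperators Matrix.Norms.Frobenius ContDiff Topology
open Matrix Complex Finset MeasureTheory Filter
open Literature.MathematicalPhysics.QuantumFieldTheory
open Literature.MathematicalPhysics.QuantumFieldTheory.SUNBakryEmery (SUN FrameIdx frame)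

namespace Summit.Ventures.YMGap.BEDoor

open Summit.Ventures.YMGap Summit.Ventures.YMGap.LatticeBakryEmery Summit.Ventures.YMGap.SharpClustering
open Summit.Ventures.YMGap.HessianSharp

universe u

/-! ## §4b G1′ PROVED: the weighted energy / covariance chain from an ABSTRACT pointwise curvature bound
(the tree's `SharpClusteringEnergy.weightedEnergy_le`, `SharpClusteringCovariance.cov_step`, `.covariance_le` verbatim, with the
single call of `Gam2W_ge` replaced by a hypothesis `K·Γ^w(u,u) ≤ Γ₂^w(u)` and admissibility replaced by positivity of `w`). -/

section Curv

variable {ι : Type u} [Fintype ι] [DecidableEq ι] {N : ℕ}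

/-- Weighted energy estimate `K² ∫ e^S Γ^w(u,u) ≤ ∫ e^S Γ^w(L_S u, L_S u)` from the pointwise curvature bound for this `u`.
[folklore] -/
theorem weightedEnergy_le_of_curv (hN : N ≠ 0) {S u : Cfg ι N → ℝ} (hS : ContDiff ℝ ∞ S) (hu : ContDiff ℝ ∞ u)
    {K : ℝ} {w : ι → ℝ} (hw0 : ∀ e, 0 ≤ w e) (hK : 0 ≤ K)
    (hcurv : ∀ g : PSU ι N, K * GamW w u u (emb g) ≤ Gam2W w S u (emb g)) :
    K ^ 2 * ∫ g : PSU ι N, Real.exp (S (emb g)) * GamW w u u (emb g) ∂(haarPi ι N) ≤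
      ∫ g : PSU ι N, Real.exp (S (emb g)) * GamW w (genL S u) (genL S u) (emb g) ∂(haarPi ι N) := by
  set A := ∫ g : PSU ι N, Real.exp (S (emb g)) * GamW w u u (emb g) ∂(haarPi ι N) with hA
  set B := ∫ g : PSU ι N, Real.exp (S (emb g)) * GamW w (genL S u) (genL S u) (emb g) ∂(haarPi ι N) with hB
  have hA0 : 0 ≤ A := integral_nonneg fun g => mul_nonneg (Real.exp_pos _).le (GamW_self_nonneg hw0 _ _)
  have hB0 : 0 ≤ B := integral_nonneg fun g => mul_nonneg (Real.exp_pos _).le (GamW_self_nonneg hw0 _ _)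
  have hKA : K * A ≤ Real.sqrt A * Real.sqrt B := by
    have h1 : K * A ≤ ∫ g : PSU ι N, Real.exp (S (emb g)) * Gam2W w S u (emb g) ∂(haarPi ι N) := by
      rw [hA, ← integral_const_mul]
      refine integral_mono ?_ ?_ fun g => ?_
      · exact (integrable_of_continuous_PSU (continuous_restrict (hS.exp.mul (contDiff_GamW w hu hu))) _).const_mul _
      · exact integrable_of_continuous_PSU (continuous_restrict (hS.exp.mul (contDiff_Gam2W w hS hu))) _
      · have h := hcurv g
        have hpos := Real.exp_pos (S (emb g))
        calc K * (Real.exp (S (emb g)) * GamW w u u (emb g))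
            = Real.exp (S (emb g)) * (K * GamW w u u (emb g)) := by ring
          _ ≤ Real.exp (S (emb g)) * Gam2W w S u (emb g) := mul_le_mul_of_nonneg_left h hpos.le
    rw [integral_exp_mul_Gam2W hN w hS hu] at h1
    have h2 := abs_integral_exp_mul_GamW_le hw0 hS hu (contDiff_genL hS hu) (haarPi ι N)
    have h3 := neg_abs_le (∫ g : PSU ι N, Real.exp (S (emb g)) * GamW w u (genL S u) (emb g) ∂(haarPi ι N))
    linarith
  by_cases hA1 : A = 0
  · rw [hA1, mul_zero]; exact hB0
  have hApos : 0 < A := lt_of_le_of_ne hA0 (Ne.symm hA1)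
  have hsA : 0 < Real.sqrt A := Real.sqrt_pos.2 hApos
  have hKs : K * Real.sqrt A ≤ Real.sqrt B := by
    have : K * Real.sqrt A * Real.sqrt A ≤ Real.sqrt B * Real.sqrt A := by
      rw [mul_assoc, Real.mul_self_sqrt hA0, mul_comm (Real.sqrt B)]; exact hKA
    exact le_of_mul_le_mul_right this hsA
  have hKs0 : 0 ≤ K * Real.sqrt A := mul_nonneg hK hsA.le
  calc K ^ 2 * A = (K * Real.sqrt A) ^ 2 := by rw [mul_pow, Real.sq_sqrt hA0]
    _ ≤ Real.sqrt B ^ 2 := pow_le_pow_left₀ hKs0 hKs 2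
    _ = B := Real.sq_sqrt hB0

/-- One step of the covariance estimate with an approximate Poisson solution `u`, from the pointwise curvature bound for
this `u` (tree `cov_step` verbatim). [folklore] -/
theorem cov_step_of_curv (hN : N ≠ 0) {S : Cfg ι N → ℝ} (hS : ContDiff ℝ ∞ S)
    {K : ℝ} {w : ι → ℝ} (hw : ∀ e, 0 < w e) (hK : 0 < K) {C : ℝ} (hC : ∀ e, w e ≤ C)
    {f gt u : Cfg ι N → ℝ} (hf : ContDiff ℝ ∞ f) (hgt : ContDiff ℝ ∞ gt) (hu : ContDiff ℝ ∞ u)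
    (hcurv : ∀ g : PSU ι N, K * GamW w u u (emb g) ≤ Gam2W w S u (emb g)) :
    K * |∫ x : PSU ι N, Real.exp (S (emb x)) * (f (emb x) * gt (emb x)) ∂(haarPi ι N)| ≤
      K * (Real.sqrt (∫ x : PSU ι N, Real.exp (S (emb x)) * f (emb x) ^ 2 ∂(haarPi ι N)) *
            Real.sqrt (∫ x : PSU ι N, Real.exp (S (emb x)) * (genL S u (emb x) - gt (emb x)) ^ 2 ∂(haarPi ι N))) +
        Real.sqrt (∫ x : PSU ι N, Real.exp (S (emb x)) * GamW (fun e => (w e)⁻¹) f f (emb x) ∂(haarPi ι N)) *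
          (Real.sqrt (∫ x : PSU ι N, Real.exp (S (emb x)) * GamW w gt gt (emb x) ∂(haarPi ι N)) +
            Real.sqrt (C * ∫ x : PSU ι N, Real.exp (S (emb x)) *
              Gam (fun Q => genL S u Q - gt Q) (fun Q => genL S u Q - gt Q) (emb x) ∂(haarPi ι N))) := by
  have hw0 : ∀ e, 0 ≤ w e := fun e => (hw e).le
  have hSc : Continuous fun x : PSU ι N => S (emb x) := continuous_restrict hS
  have hEc : Continuous fun x : PSU ι N => Real.exp (S (emb x)) := Real.continuous_exp.comp hSc
  have hLc : ContDiff ℝ ∞ (genL S u) := contDiff_genL hS hu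
  have hr : ContDiff ℝ ∞ (fun Q => genL S u Q - gt Q) := hLc.sub hgt
  set I := ∫ x : PSU ι N, Real.exp (S (emb x)) * (f (emb x) * gt (emb x)) ∂(haarPi ι N) with hI
  set D := ∫ x : PSU ι N, Real.exp (S (emb x)) * (f (emb x) * (genL S u (emb x) - gt (emb x))) ∂(haarPi ι N) with hD
  set G := ∫ x : PSU ι N, Real.exp (S (emb x)) * Gam f u (emb x) ∂(haarPi ι N) with hG
  set F2 := ∫ x : PSU ι N, Real.exp (S (emb x)) * f (emb x) ^ 2 ∂(haarPi ι N) with hF2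
  set E1 := ∫ x : PSU ι N, Real.exp (S (emb x)) * (genL S u (emb x) - gt (emb x)) ^ 2 ∂(haarPi ι N) with hE1
  set Af := Real.sqrt (∫ x : PSU ι N, Real.exp (S (emb x)) * GamW (fun e => (w e)⁻¹) f f (emb x) ∂(haarPi ι N))
    with hAf
  set Vu := ∫ x : PSU ι N, Real.exp (S (emb x)) * GamW w u u (emb x) ∂(haarPi ι N) with hVu
  set VL := ∫ x : PSU ι N, Real.exp (S (emb x)) * GamW w (genL S u) (genL S u) (emb x) ∂(haarPi ι N) with hVL
  set Bg := Real.sqrt (∫ x : PSU ι N, Real.exp (S (emb x)) * GamW w gt gt (emb x) ∂(haarPi ι N)) with hBg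
  set E2 := ∫ x : PSU ι N, Real.exp (S (emb x)) *
    Gam (fun Q => genL S u Q - gt Q) (fun Q => genL S u Q - gt Q) (emb x) ∂(haarPi ι N) with hE2
  have iL : Integrable (fun x : PSU ι N => f (emb x) * (Real.exp (S (emb x)) * genL S u (emb x))) (haarPi ι N) :=
    integrable_of_continuous_PSU ((continuous_restrict hf).mul (hEc.mul (continuous_restrict hLc))) _
  have iD : Integrable (fun x : PSU ι N => Real.exp (S (emb x)) * (f (emb x) * (genL S u (emb x) - gt (emb x))))
      (haarPi ι N) :=
    integrable_of_continuous_PSU (hEc.mul ((continuous_restrict hf).mul (continuous_restrict hr))) _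
  have ha : I = -G - D := by
    have e1 : I = (∫ x : PSU ι N, f (emb x) * (Real.exp (S (emb x)) * genL S u (emb x)) ∂(haarPi ι N)) - D := by
      rw [hI, hD, ← integral_sub iL iD]
      exact integral_congr_ae (ae_of_all _ fun x => by ring)
    rw [e1, integral_mul_exp_mul_genL hN hS hf hu]
  have hb : |D| ≤ Real.sqrt F2 * Real.sqrt E1 :=
    abs_integral_exp_mul_mul_le (S := fun x : PSU ι N => S (emb x)) (f := fun x => f (emb x))
      (g := fun x => genL S u (emb x) - gt (emb x)) hSc (continuous_restrict hf) (continuous_restrict hr) _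
  have hc : |G| ≤ Af * Real.sqrt Vu := abs_integral_exp_mul_Gam_le_mixed w hw hS hf hu _
  have hd : K * Real.sqrt Vu ≤ Real.sqrt VL := by
    have hen := weightedEnergy_le_of_curv hN hS hu hw0 hK.le hcurv
    calc K * Real.sqrt Vu = Real.sqrt (K ^ 2) * Real.sqrt Vu := by rw [Real.sqrt_sq hK.le]
      _ = Real.sqrt (K ^ 2 * Vu) := (Real.sqrt_mul (sq_nonneg _) Vu).symm
      _ ≤ Real.sqrt VL := Real.sqrt_le_sqrt hen
  have he : Real.sqrt VL ≤ Bg + Real.sqrt (∫ x : PSU ι N, Real.exp (S (emb x)) *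
      GamW w (fun Q => genL S u Q - gt Q) (fun Q => genL S u Q - gt Q) (emb x) ∂(haarPi ι N)) := by
    have hM := sqrt_integral_GamW_add_le hw0 hS hgt hr (u := gt) (r := fun Q => genL S u Q - gt Q)
    have eL : (gt + fun Q => genL S u Q - gt Q) = genL S u := by
      funext Q; simp only [Pi.add_apply]; ring
    rw [eL] at hM
    rw [hVL, hBg]
    exact hM
  have hf' : ∫ x : PSU ι N, Real.exp (S (emb x)) *
      GamW w (fun Q => genL S u Q - gt Q) (fun Q => genL S u Q - gt Q) (emb x) ∂(haarPi ι N) ≤ C * E2 := by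
    rw [hE2, ← integral_const_mul]
    refine integral_mono (integrable_of_continuous_PSU (hEc.mul (continuous_restrict (contDiff_GamW w hr hr))) _)
      ((integrable_of_continuous_PSU (hEc.mul (continuous_restrict (contDiff_Gam hr hr))) _).const_mul C)
      fun x => ?_
    have := GamW_le_const_mul_Gam hC (fun Q => genL S u Q - gt Q) (emb x)
    have hpos := Real.exp_pos (S (emb x))
    nlinarith
  have hAf0 : 0 ≤ Af := Real.sqrt_nonneg _
  have h1 : |I| ≤ |G| + |D| := by
    rw [ha]
    have := abs_add_le (-G) (-D)
    rwa [abs_neg, abs_neg, ← sub_eq_add_neg] at this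
  have h2 : K * |G| ≤ Af * (Bg + Real.sqrt (C * E2)) := by
    have h21 : K * |G| ≤ Af * (K * Real.sqrt Vu) := by nlinarith [hc, hK.le, Real.sqrt_nonneg Vu]
    have h22 : K * Real.sqrt Vu ≤ Bg + Real.sqrt (C * E2) :=
      hd.trans (he.trans (add_le_add le_rfl (Real.sqrt_le_sqrt hf')))
    exact h21.trans (mul_le_mul_of_nonneg_left h22 hAf0)
  calc K * |I| ≤ K * (|G| + |D|) := mul_le_mul_of_nonneg_left h1 hK.le
    _ = K * |D| + K * |G| := by ring
    _ ≤ K * (Real.sqrt F2 * Real.sqrt E1) + Af * (Bg + Real.sqrt (C * E2)) :=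
        add_le_add (mul_le_mul_of_nonneg_left hb hK.le) h2

/-- ★ **G1′ PROVED: the weighted covariance bound from an ABSTRACT pointwise curvature bound** (tree `covariance_le`
verbatim; polynomial `S` still needed for the approximate Poisson solutions `exists_approx_poisson`). [folklore] -/
theorem covariance_le_of_curv (hN : N ≠ 0) {dS : ℕ} {S : Cfg ι N → ℝ} (hSp : S ∈ polySpace ι N dS)
    {K : ℝ} {w : ι → ℝ} (hw : ∀ e, 0 < w e) (hK : 0 < K)
    (hcurv : ∀ u : Cfg ι N → ℝ, ContDiff ℝ ∞ u → ∀ g : PSU ι N, K * GamW w u u (emb g) ≤ Gam2W w S u (emb g))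
    {f g : Cfg ι N → ℝ} (hf : ContDiff ℝ ∞ f) (hg : ContDiff ℝ ∞ g) :
    K * |(∫ x : PSU ι N, Real.exp (S (emb x)) ∂(haarPi ι N)) *
            (∫ x : PSU ι N, Real.exp (S (emb x)) * (f (emb x) * g (emb x)) ∂(haarPi ι N)) -
          (∫ x : PSU ι N, Real.exp (S (emb x)) * f (emb x) ∂(haarPi ι N)) *
            (∫ x : PSU ι N, Real.exp (S (emb x)) * g (emb x) ∂(haarPi ι N))| ≤
      (∫ x : PSU ι N, Real.exp (S (emb x)) ∂(haarPi ι N)) *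
        (Real.sqrt (∫ x : PSU ι N, Real.exp (S (emb x)) * GamW (fun e => (w e)⁻¹) f f (emb x) ∂(haarPi ι N)) *
          Real.sqrt (∫ x : PSU ι N, Real.exp (S (emb x)) * GamW w g g (emb x) ∂(haarPi ι N))) := by
  have hS : ContDiff ℝ ∞ S := contDiff_of_mem_polySpace hSp
  have hSc : Continuous fun x : PSU ι N => S (emb x) := continuous_restrict hS
  have hEc : Continuous fun x : PSU ι N => Real.exp (S (emb x)) := Real.continuous_exp.comp hSc
  have hw0 : ∀ e, 0 ≤ w e := fun e => (hw e).le
  set Z : ℝ := ∫ x : PSU ι N, Real.exp (S (emb x)) ∂(haarPi ι N) with hZ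
  have hZpos : 0 < Z := integral_exp_pos (integrable_of_continuous_PSU hEc _)
  have hZne : Z ≠ 0 := hZpos.ne'
  set m : ℝ := (∫ x : PSU ι N, Real.exp (S (emb x)) * g (emb x) ∂(haarPi ι N)) / Z with hm
  have hgm : ContDiff ℝ ∞ (fun Q => g Q - m) := hg.sub contDiff_const
  set Af := Real.sqrt (∫ x : PSU ι N, Real.exp (S (emb x)) * GamW (fun e => (w e)⁻¹) f f (emb x) ∂(haarPi ι N))
    with hAf
  set Bg := Real.sqrt (∫ x : PSU ι N, Real.exp (S (emb x)) * GamW w g g (emb x) ∂(haarPi ι N)) with hBg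
  set I : ℝ := ∫ x : PSU ι N, Real.exp (S (emb x)) * (f (emb x) * (g (emb x) - m)) ∂(haarPi ι N) with hI
  have hcov : Z * (∫ x : PSU ι N, Real.exp (S (emb x)) * (f (emb x) * g (emb x)) ∂(haarPi ι N)) -
      (∫ x : PSU ι N, Real.exp (S (emb x)) * f (emb x) ∂(haarPi ι N)) *
        (∫ x : PSU ι N, Real.exp (S (emb x)) * g (emb x) ∂(haarPi ι N)) = Z * I := by
    have i1 : Integrable (fun x : PSU ι N => Real.exp (S (emb x)) * (f (emb x) * g (emb x))) (haarPi ι N) :=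
      integrable_of_continuous_PSU (hEc.mul ((continuous_restrict hf).mul (continuous_restrict hg))) _
    have i2 : Integrable (fun x : PSU ι N => m * (Real.exp (S (emb x)) * f (emb x))) (haarPi ι N) :=
      (integrable_of_continuous_PSU (hEc.mul (continuous_restrict hf)) _).const_mul m
    have e1 : I = (∫ x : PSU ι N, Real.exp (S (emb x)) * (f (emb x) * g (emb x)) ∂(haarPi ι N)) -
        m * ∫ x : PSU ι N, Real.exp (S (emb x)) * f (emb x) ∂(haarPi ι N) := by
      rw [hI, ← integral_const_mul, ← integral_sub i1 i2]
      exact integral_congr_ae (ae_of_all _ fun x => by ring)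
    have e2 : m * Z = ∫ x : PSU ι N, Real.exp (S (emb x)) * g (emb x) ∂(haarPi ι N) := by
      rw [hm, div_mul_cancel₀ _ hZne]
    rw [e1, mul_sub, ← e2]
    ring
  have hmean : ∫ x : PSU ι N, Real.exp (S (emb x)) * (g (emb x) - m) ∂(haarPi ι N) = 0 := by
    have i1 : Integrable (fun x : PSU ι N => Real.exp (S (emb x)) * g (emb x)) (haarPi ι N) :=
      integrable_of_continuous_PSU (hEc.mul (continuous_restrict hg)) _
    have i2 : Integrable (fun x : PSU ι N => m * Real.exp (S (emb x))) (haarPi ι N) :=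
      (integrable_of_continuous_PSU hEc _).const_mul m
    have e1 : ∫ x : PSU ι N, Real.exp (S (emb x)) * (g (emb x) - m) ∂(haarPi ι N) =
        (∫ x : PSU ι N, Real.exp (S (emb x)) * g (emb x) ∂(haarPi ι N)) - m * Z := by
      rw [hZ, ← integral_const_mul, ← integral_sub i1 i2]
      exact integral_congr_ae (ae_of_all _ fun x => by ring)
    rw [e1, hm, div_mul_cancel₀ _ hZne, sub_self]
  obtain ⟨v, hvc, t1, t2⟩ := exists_approx_poisson hN hSp hg hmean
  obtain ⟨C, hC⟩ : ∃ C : ℝ, ∀ e, w e ≤ C :=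
    ⟨∑ e, w e, fun e => single_le_sum (fun e _ => hw0 e) (mem_univ e)⟩
  set F2 := ∫ x : PSU ι N, Real.exp (S (emb x)) * f (emb x) ^ 2 ∂(haarPi ι N) with hF2
  have hBg' : Real.sqrt (∫ x : PSU ι N, Real.exp (S (emb x)) *
      GamW w (fun Q => g Q - m) (fun Q => g Q - m) (emb x) ∂(haarPi ι N)) = Bg := by
    rw [hBg, GamW_sub_const w hg m]
  have hstep : ∀ k, K * |I| ≤ K * (Real.sqrt F2 * Real.sqrt (∫ x : PSU ι N, Real.exp (S (emb x)) *
      (genL S (v k) (emb x) - (g (emb x) - m)) ^ 2 ∂(haarPi ι N))) +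
        Af * (Bg + Real.sqrt (C * ∫ x : PSU ι N, Real.exp (S (emb x)) *
          Gam (fun Q => genL S (v k) Q - (g Q - m)) (fun Q => genL S (v k) Q - (g Q - m)) (emb x) ∂(haarPi ι N))) := by
    intro k
    have := cov_step_of_curv hN hS hw hK hC hf hgm (hvc k) (hcurv _ (hvc k))
    rw [hBg'] at this
    exact this
  have hlim : Tendsto (fun k => K * (Real.sqrt F2 * Real.sqrt (∫ x : PSU ι N, Real.exp (S (emb x)) *
      (genL S (v k) (emb x) - (g (emb x) - m)) ^ 2 ∂(haarPi ι N))) +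
        Af * (Bg + Real.sqrt (C * ∫ x : PSU ι N, Real.exp (S (emb x)) *
          Gam (fun Q => genL S (v k) Q - (g Q - m)) (fun Q => genL S (v k) Q - (g Q - m)) (emb x) ∂(haarPi ι N))))
      atTop (𝓝 (K * (Real.sqrt F2 * 0) + Af * (Bg + 0))) := by
    have s1 : Tendsto (fun k => Real.sqrt (∫ x : PSU ι N, Real.exp (S (emb x)) *
        (genL S (v k) (emb x) - (g (emb x) - m)) ^ 2 ∂(haarPi ι N))) atTop (𝓝 0) := by
      have := (Real.continuous_sqrt.tendsto 0).comp t1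
      rwa [Real.sqrt_zero] at this
    have s2 : Tendsto (fun k => Real.sqrt (C * ∫ x : PSU ι N, Real.exp (S (emb x)) *
        Gam (fun Q => genL S (v k) Q - (g Q - m)) (fun Q => genL S (v k) Q - (g Q - m)) (emb x) ∂(haarPi ι N)))
        atTop (𝓝 0) := by
      have t2' : Tendsto (fun k => C * ∫ x : PSU ι N, Real.exp (S (emb x)) *
          Gam (fun Q => genL S (v k) Q - (g Q - m)) (fun Q => genL S (v k) Q - (g Q - m)) (emb x) ∂(haarPi ι N))
          atTop (𝓝 0) := by simpa using t2.const_mul C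
      have := (Real.continuous_sqrt.tendsto 0).comp t2'
      rwa [Real.sqrt_zero] at this
    exact ((s1.const_mul _).const_mul _).add ((s2.const_add _).const_mul _)
  have hfinal : K * |I| ≤ K * (Real.sqrt F2 * 0) + Af * (Bg + 0) :=
    le_of_tendsto_of_tendsto' tendsto_const_nhds hlim hstep
  rw [mul_zero, mul_zero, zero_add, add_zero] at hfinal
  rw [hcov, abs_mul, abs_of_pos hZpos]
  calc K * (Z * |I|) = Z * (K * |I|) := by ring
    _ ≤ Z * (Af * Bg) := mul_le_mul_of_nonneg_left hfinal hZpos.le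

/-- Hence the `Prop` `CovarianceLeOfCurvature` of §4 HOLDS. [folklore] -/
theorem covarianceLeOfCurvature_holds : CovarianceLeOfCurvature :=
  fun _ _ _ _ hN _ _ hSp _ _ hw hK hcurv _ _ hf hg => covariance_le_of_curv hN hSp hw hK hcurv hf hg

/-- ★★ **THE QUASI-LOCAL WEIGHTED COVARIANCE BOUND (unconditional):** for polynomial `S` with `HessBound S Λ`,
`OffDiagHessBound S h` (`h ≥ 0`, ANY range), GENERAL positive weights `w` whose `θ`-row/column sums are `≤ Θ`, and
`K = N/2 − Λ − Θ > 0`:  `K·|Z ∫ e^S fg − ∫ e^S f ∫ e^S g| ≤ Z·‖∇f‖_{1/w}·‖∇g‖_{w}`.  This is the input of the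
exponential-clustering bookkeeping for an infinite-range, exponentially decaying interaction (`w = ρ^{dist}`), i.e. for a
QUASI-LOCAL remainder as produced by a renormalisation-group step — the tree's `covariance_le` needs `h e e' = 0` beyond
range 1 of the weight profile. [folklore] -/
theorem covariance_le_theta (hN : N ≠ 0) {dS : ℕ} {S : Cfg ι N → ℝ} (hSp : S ∈ polySpace ι N dS)
    {Λ Θ : ℝ} {h : ι → ι → ℝ} {w : ι → ℝ} (hHess : HessBound S Λ) (hOff : OffDiagHessBound S h)
    (hh0 : ∀ e e', 0 ≤ h e e') (hw : ∀ e, 0 < w e)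
    (hrow : ∀ e, ∑ e', h e e' * |Real.sqrt (w e / w e') - 1| ≤ Θ)
    (hcol : ∀ e', ∑ e, h e e' * |Real.sqrt (w e / w e') - 1| ≤ Θ) (hK : 0 < (N : ℝ) / 2 - Λ - Θ)
    {f g : Cfg ι N → ℝ} (hf : ContDiff ℝ ∞ f) (hg : ContDiff ℝ ∞ g) :
    ((N : ℝ) / 2 - Λ - Θ) *
        |(∫ x : PSU ι N, Real.exp (S (emb x)) ∂(haarPi ι N)) *
            (∫ x : PSU ι N, Real.exp (S (emb x)) * (f (emb x) * g (emb x)) ∂(haarPi ι N)) -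
          (∫ x : PSU ι N, Real.exp (S (emb x)) * f (emb x) ∂(haarPi ι N)) *
            (∫ x : PSU ι N, Real.exp (S (emb x)) * g (emb x) ∂(haarPi ι N))| ≤
      (∫ x : PSU ι N, Real.exp (S (emb x)) ∂(haarPi ι N)) *
        (Real.sqrt (∫ x : PSU ι N, Real.exp (S (emb x)) * GamW (fun e => (w e)⁻¹) f f (emb x) ∂(haarPi ι N)) *
          Real.sqrt (∫ x : PSU ι N, Real.exp (S (emb x)) * GamW w g g (emb x) ∂(haarPi ι N))) :=
  covariance_le_of_curv hN hSp hw hK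
    (fun _ hu g' => Gam2W_ge_theta hN (contDiff_of_mem_polySpace hSp) hu hHess hOff hh0 hw hrow hcol g') hf hg

end Curv

end Summit.Ventures.YMGap.BEDoor
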